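import Summits.AtomisticToContinuum.Crystallization.Theses.VdwKissingSutherland

/-!
# Birth skeleton (BC3) for crux `SutherlandStable` (stmt-AtomisticToContinuum-12231)

Route `VdwKissingSutherland`, sub-problem `Crystallization`; registrar
`planner-skel-stmt-AtomisticToContinuum-12231-0` (2026-08-17).  Published as
`Cruxes/SutherlandStable/Lines/birth.lean`.

## The crux

For every finite unit packing `x : Fin N → ℝ³` (pairwise distances `≥ 1`)

  `Σ_i Σ_j d_ij⁻⁶ + (1/10)·Σ_i (51/4 − S_i) ≤ N · L₆(hcp)`,

`S_i = Σ_{j ≠ i, d_ij ≤ 3/2} d_ij⁻⁶` the two-shell sum, `L₆(hcp) = Σ'_{y ∈ hcp} ‖y‖⁻⁶ = 14.45490`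
(nearest-neighbour distance `1`).  Equivalently (`T_i` = site sum beyond `3/2`, `T_hcp = L₆ − 51/4`):
the far-field excess `Σ_i (T_i − T_hcp)` is at most `9/10` of the total two-shell deficit.

## The line: RANGE SPLITTING WITH A HALF REFUND

Split the field beyond `3/2` once more, SOFTLY, at radii `3 … 5`:

* `midWeight t` = `0` for `t ≤ 3/2`, `1` on `(3/2, 3]`, the linear ramp `(5 − t)/2` on `[3, 5]`,
  `0` beyond `5`;  `M_i = Σ_j midWeight(d_ij) d_ij⁻⁶` (finite range `5`);
* `farWeight t` = `1_{t > 3/2} − midWeight t` (ramps up on `[3, 5]`, `1` beyond);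
  `F_i = Σ_j farWeight(d_ij) d_ij⁻⁶`;
* `hcpMid = Σ'_{y ∈ hcp} midWeight ‖y‖ · ‖y‖⁻⁶ = 1.59921…` is the hcp value of `M_i`, and the hcp
  value of `F_i` is written `L₆(hcp) − 51/4 − hcpMid = 0.10569…` (the two inner shells of hcp,
  `12 × 1 + 6 × (√2)⁻⁶`, are exactly `51/4`).

Then `Σ_j d_ij⁻⁶ = S_i + M_i + F_i` sitewise (the diagonal term is `0⁻¹ ^ 6 = 0`), and the crux is the
positive combination `½ · (MID) + (FAR)` of the two registered stubs

* `stub_midRange`  (finite range, averaged):  `Σ_i M_i ≤ N·hcpMid + (7/10)·Σ_i (51/4 − S_i)` —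
  "hcp minimises the energy of the TRUNCATED discounted van der Waals potential
  `−(7/10)·1_{d ≤ 3/2} d⁻⁶ − midWeight(d) d⁻⁶` (range 5) over hard-sphere configurations": a
  Flyspeck-type local-to-global statement with finitely many local configurations to certify;
* `stub_farRange`  (infinite range, averaged, HALF refund of the unused mid credit):
  `Σ_i F_i ≤ N·(L₆ − 51/4 − hcpMid) + ½·Σ_i [(7/10)(51/4 − S_i) + hcpMid − M_i] + (1/5)·Σ_i (51/4 − S_i)`
  — the field beyond radius `3` (`≈ 0.106` per site) exceeds hcp's only through coarse over-density
  at scales `≥ 3`, which Kepler-type density control plus the deficits of the defective sites that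
  any locally over-dense motif contains must pay for (a density statement, not a kissing statement).

Composition (`SutherlandStable_of_stubs`, sorry-free, pure finite algebra; `SutherlandStable_of :
SutherlandStable` applies it to the two named stubs): `(FAR) + ½·(MID)` gives
`Σ_i (M_i + F_i) ≤ N·(L₆ − 51/4) + (7/20 + 7/20 + 1/5)·Σ_i def_i = N·T_hcp + (9/10)·Σ_i def_i`, and
`Σ_i S_i = N·51/4 − Σ_i def_i` turns this into the crux.  The refund fraction `θ = 1/2` is a design
parameter: `θ = 1` would make (FAR) the crux itself and (MID) idle, `θ = 0` would forbid (FAR) to use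
the mid-range slack that Barlow polytype sites genuinely need; any `θ ∈ (0,1)` is a decomposition,
`1/2` balances the two.

## Calibration (folder `calc/layers.py`, `calc/zoo.py`, pure python, this session)

Barlow layer sums at nn-distance 1 (site in layer 0, layer `k` at height `k√(2/3)`, aligned `A` vs
staggered `B/C` lateral offset), split by the weights above: `D₂ = 4.886e-4 = (+2.874e-4 mid,
+2.012e-4 far)`, `D₃ = 4.5e-7 = (+1.556e-4, −1.551e-4)`, `D₄ = 4.2e-10 = (+3.0e-6, −3.0e-6)`.
Per-site slacks of (MID) / (FAR) at deficit `0` (both must be `≥ 0` on average over a crystal):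
fcc `+2.70e-4 / +8.41e-4`; dhcp, 4H `≥ 0` pointwise; 6H `+2.7e-4 / +3.4e-4` worst; 9R worst
`−5.9e-7 / +3.0e-7`, average `+1.9e-4 / +2.3e-4`; a twin fault `(AB)⁴(CB)⁴` worst `−3.6e-6 / 0`,
average `+7.1e-5 / +8.7e-5` — pointwise (MID) fails by `≤ 4e-6` exactly at sites whose first
deviation from hcp is an even layer `k ≥ 4`, and every such site lies next to a `c`-type layer whose
sites carry `+2.9e-4` each, so the AVERAGED stubs hold for all Barlow polytypes with a factor `≈ 50`
to spare (this is why both stubs are averaged and why the split is soft: a sharp cut at radius `2`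
hands fcc a far-field gain of `+0.032` per site against a total hcp advantage of `0.00098`).
Non-Barlow lattices at unit nn-distance (slack MID / FAR / crux): bcc `+1.53 / +1.22 / +1.98`,
sc `+4.45 / +3.31 / +5.53`, simple hexagonal `+2.92 / +2.13 / +3.59`, diamond `+6.66 / +5.14 / +8.46`.
Icosahedral packing centre (route NUMBERS): deficit `3/4`, mid excess within radius `2` is `+0.322 <
(7/10)·(3/4) = 0.525`.

## Disproof used
No `Disproof.lean` is filed for this crux (`ledger crux ls`: no workfiles before this one); the
negatives index entries for Crystallization (EffectiveLocalHales at tolerance 1/100, OneGrainGluing)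
concern soft shells / grain gluing and do not type against either stub (both are averaged energy
inequalities at tolerance 0 with hcp as the equality case).

## Why each stub might fail
* MID: an exotic packing whose sites have near-Barlow two-shells (small deficit) but `≥ 0.7·def`
  more `r⁻⁶`-mass in `(3/2, 5]` than hcp on AVERAGE (decahedral / Frank–Kasper-like motifs: the D5h
  contact shell has deficit only `0.09`); cheapest falsifier: per-site evaluation on the refuter's
  39-packing zoo (evidence `zoo_local.py` on the item) with the weights above.
* FAR: a packing that is coarsely denser than hcp at scales `3–10` around deficit-free sites (none can
  be at scale `∞`: Kepler/Hales), or Barlow polytypes if the ramp were sharp (it is not; see table).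
-/

noncomputable section

namespace Summit.AtomisticToContinuum.Crystallization.Cruxes.SutherlandStable.Birth

open scoped BigOperators Classical
open Literature.MathematicalPhysics.StatisticalMechanics
open Summit.AtomisticToContinuum.Crystallization.Theses.VdwKissingSutherland

/-- Mid-range weight: `0` on `[0, 3/2]` (the two-shell, weighted separately), `1` on `(3/2, 3]`,
the linear ramp `(5 − t)/2` on `[3, 5]`, `0` beyond `5`. -/
def midWeight (t : ℝ) : ℝ := if t ≤ 3 / 2 then 0 else min 1 (max 0 ((5 - t) / 2))

/-- Far-range weight: the rest of the field beyond `3/2`, `1_{t > 3/2} − midWeight t`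
(`0` up to `3`, ramp on `[3, 5]`, `1` beyond `5`). -/
def farWeight (t : ℝ) : ℝ := (if t ≤ 3 / 2 then 0 else 1) - midWeight t

/-- The hcp benchmark of the mid-range site sum: `Σ'_{y ∈ hcp} midWeight ‖y‖ · ‖y‖⁻⁶ = 1.59921…`
(nearest-neighbour distance `1`; the origin and the two inner shells carry weight `0`). -/
def hcpMid : ℝ :=
  ∑' y : ↥(hcpStacking 1 (Real.sqrt (2 / 3))),
    midWeight ‖(y : EuclideanSpace ℝ (Fin 3))‖ * ‖(y : EuclideanSpace ℝ (Fin 3))‖⁻¹ ^ 6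

/-- **stub MID (finite-range deficit-stable Sutherland inequality, range 5, averaged).**
For every finite unit packing, the total mid-range mass `Σ_i M_i` exceeds `N · hcpMid` by at most
`7/10` of the total two-shell deficit.  Size: XL (a finite-range ground-state / local-to-global
certificate in `ℝ³`; hcp bulk is the equality case; Barlow polytypes pass on average, table above). -/
theorem stub_midRange :
    ∀ (N : ℕ) (x : Fin N → EuclideanSpace ℝ (Fin 3)), (∀ i j, i ≠ j → 1 ≤ dist (x i) (x j)) →
      ∑ i, ∑ j, midWeight (dist (x i) (x j)) * (dist (x i) (x j))⁻¹ ^ 6 ≤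
        (N : ℝ) * hcpMid +
          (7 / 10) * ∑ i, (51 / 4 - ∑ j ∈ Finset.univ.filter
            (fun j => j ≠ i ∧ dist (x i) (x j) ≤ 3 / 2), (dist (x i) (x j))⁻¹ ^ 6) := by
  sorry

/-- **stub FAR (far-field transfer with half refund, averaged).**  For every finite unit packing,
the total far-range mass `Σ_i F_i` exceeds `N · (L₆(hcp) − 51/4 − hcpMid)` by at most one half of
the unused mid-range credit `Σ_i [(7/10)(51/4 − S_i) + hcpMid − M_i]` plus `1/5` of the total
two-shell deficit.  Size: XL (Kepler-type coarse density control at scales `≥ 3` with deficits as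
the currency; hcp bulk is the equality case). -/
theorem stub_farRange :
    ∀ (N : ℕ) (x : Fin N → EuclideanSpace ℝ (Fin 3)), (∀ i j, i ≠ j → 1 ≤ dist (x i) (x j)) →
      ∑ i, ∑ j, farWeight (dist (x i) (x j)) * (dist (x i) (x j))⁻¹ ^ 6 ≤
        (N : ℝ) * ((∑' y : ↥(hcpStacking 1 (Real.sqrt (2 / 3))),
            ‖(y : EuclideanSpace ℝ (Fin 3))‖⁻¹ ^ 6) - 51 / 4 - hcpMid) +
          (1 / 2) * ((7 / 10) * ∑ i, (51 / 4 - ∑ j ∈ Finset.univ.filter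
              (fun j => j ≠ i ∧ dist (x i) (x j) ≤ 3 / 2), (dist (x i) (x j))⁻¹ ^ 6) +
            (N : ℝ) * hcpMid - ∑ i, ∑ j, midWeight (dist (x i) (x j)) * (dist (x i) (x j))⁻¹ ^ 6) +
          (1 / 5) * ∑ i, (51 / 4 - ∑ j ∈ Finset.univ.filter
            (fun j => j ≠ i ∧ dist (x i) (x j) ≤ 3 / 2), (dist (x i) (x j))⁻¹ ^ 6) := by
  sorry

/-- Sitewise range split: `Σ_j d_ij⁻⁶ = S_i + M_i + F_i` (the diagonal term is `0⁻¹ ^ 6 = 0`, and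
`1_{≤ 3/2} + midWeight + farWeight = 1` off the diagonal). -/
theorem site_split {N : ℕ} (x : Fin N → EuclideanSpace ℝ (Fin 3)) (i : Fin N) :
    ∑ j, (dist (x i) (x j))⁻¹ ^ 6 =
      (∑ j ∈ Finset.univ.filter (fun j => j ≠ i ∧ dist (x i) (x j) ≤ 3 / 2),
          (dist (x i) (x j))⁻¹ ^ 6) +
        ∑ j, midWeight (dist (x i) (x j)) * (dist (x i) (x j))⁻¹ ^ 6 +
        ∑ j, farWeight (dist (x i) (x j)) * (dist (x i) (x j))⁻¹ ^ 6 := by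
  rw [Finset.sum_filter, ← Finset.sum_add_distrib, ← Finset.sum_add_distrib]
  refine Finset.sum_congr rfl fun j _ => ?_
  by_cases hij : j = i
  · subst hij
    simp [farWeight, midWeight]
  · by_cases hd : dist (x i) (x j) ≤ 3 / 2
    · simp [farWeight, midWeight, hij, hd]
    · simp only [farWeight, midWeight, hij, hd, ne_eq, not_false_eq_true, and_false, if_false]
      ring

/-- **Composition, implication form.** `½·(MID) + (FAR)` is the crux: the statements of
`stub_midRange` and `stub_farRange` imply `SutherlandStable` (by name); sorry-free finite algebra,
axioms `propext, Classical.choice, Quot.sound`. -/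
theorem SutherlandStable_of_stubs :
    (∀ (N : ℕ) (x : Fin N → EuclideanSpace ℝ (Fin 3)), (∀ i j, i ≠ j → 1 ≤ dist (x i) (x j)) →
      ∑ i, ∑ j, midWeight (dist (x i) (x j)) * (dist (x i) (x j))⁻¹ ^ 6 ≤
        (N : ℝ) * hcpMid +
          (7 / 10) * ∑ i, (51 / 4 - ∑ j ∈ Finset.univ.filter
            (fun j => j ≠ i ∧ dist (x i) (x j) ≤ 3 / 2), (dist (x i) (x j))⁻¹ ^ 6)) →
    (∀ (N : ℕ) (x : Fin N → EuclideanSpace ℝ (Fin 3)), (∀ i j, i ≠ j → 1 ≤ dist (x i) (x j)) →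
      ∑ i, ∑ j, farWeight (dist (x i) (x j)) * (dist (x i) (x j))⁻¹ ^ 6 ≤
        (N : ℝ) * ((∑' y : ↥(hcpStacking 1 (Real.sqrt (2 / 3))),
            ‖(y : EuclideanSpace ℝ (Fin 3))‖⁻¹ ^ 6) - 51 / 4 - hcpMid) +
          (1 / 2) * ((7 / 10) * ∑ i, (51 / 4 - ∑ j ∈ Finset.univ.filter
              (fun j => j ≠ i ∧ dist (x i) (x j) ≤ 3 / 2), (dist (x i) (x j))⁻¹ ^ 6) +
            (N : ℝ) * hcpMid - ∑ i, ∑ j, midWeight (dist (x i) (x j)) * (dist (x i) (x j))⁻¹ ^ 6) +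
          (1 / 5) * ∑ i, (51 / 4 - ∑ j ∈ Finset.univ.filter
            (fun j => j ≠ i ∧ dist (x i) (x j) ≤ 3 / 2), (dist (x i) (x j))⁻¹ ^ 6)) →
    SutherlandStable := by
  intro hM hF N x hx
  have h1 := hM N x hx
  have h2 := hF N x hx
  -- total field = two-shell + mid + far, summed over sites
  have hsum : ∑ i, ∑ j, (dist (x i) (x j))⁻¹ ^ 6 =
      ∑ i, (∑ j ∈ Finset.univ.filter (fun j => j ≠ i ∧ dist (x i) (x j) ≤ 3 / 2),
          (dist (x i) (x j))⁻¹ ^ 6) +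
        ∑ i, ∑ j, midWeight (dist (x i) (x j)) * (dist (x i) (x j))⁻¹ ^ 6 +
        ∑ i, ∑ j, farWeight (dist (x i) (x j)) * (dist (x i) (x j))⁻¹ ^ 6 := by
    rw [Finset.sum_congr rfl fun i _ => site_split x i, Finset.sum_add_distrib,
      Finset.sum_add_distrib]
  -- total deficit = N · 51/4 − total two-shell mass
  have hdef : ∑ i, (51 / 4 - ∑ j ∈ Finset.univ.filter (fun j => j ≠ i ∧ dist (x i) (x j) ≤ 3 / 2),
      (dist (x i) (x j))⁻¹ ^ 6) =
      (N : ℝ) * (51 / 4) - ∑ i, ∑ j ∈ Finset.univ.filter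
        (fun j => j ≠ i ∧ dist (x i) (x j) ≤ 3 / 2), (dist (x i) (x j))⁻¹ ^ 6 := by
    rw [Finset.sum_sub_distrib, Finset.sum_const, Finset.card_univ, Fintype.card_fin, nsmul_eq_mul]
  have e : (N : ℝ) * ((∑' y : ↥(hcpStacking 1 (Real.sqrt (2 / 3))),
      ‖(y : EuclideanSpace ℝ (Fin 3))‖⁻¹ ^ 6) - 51 / 4 - hcpMid) =
      (N : ℝ) * (∑' y : ↥(hcpStacking 1 (Real.sqrt (2 / 3))), ‖(y : EuclideanSpace ℝ (Fin 3))‖⁻¹ ^ 6)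
        - (N : ℝ) * (51 / 4) - (N : ℝ) * hcpMid := by
    ring
  linarith [h1, h2, hsum, hdef, e]

/-- **Composition (registered form).** The crux `SutherlandStable`, by name, from the two named stubs
`stub_midRange`, `stub_farRange` through `SutherlandStable_of_stubs`; the only `sorry`s in its closure
are the two stubs. -/
theorem SutherlandStable_of : SutherlandStable :=
  SutherlandStable_of_stubs stub_midRange stub_farRange

end Summit.AtomisticToContinuum.Crystallization.Cruxes.SutherlandStable.Birth

end
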